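import Summits.Ventures.HSemireg.WedgeHankelRecurrenceGaussChebyshevSGcd

/-!
# Venture HSemireg — **THE VIETA–LUCAS ∕ DICKSON NORMALISATION `C_n(x) = 2 T_n(x∕2)`: THE IDEAL `(C_m, C_n)` OF `R[X]` FOR EVERY COMMUTATIVE RING IS `(C_{gcd(m,n)})` WHEN `m ∕ gcd`,
# `n ∕ gcd` ARE BOTH ODD AND `(2, C_{gcd(m,n)})` OTHERWISE** — so the «coprime» alternative of the `T`-dichotomy N458 becomes the ideal `(2, C_g)`, which is the unit ideal iff `2` is a unit:
# over `ℤ` (or any ring mapping to `𝔽₂`) **no two Dickson polynomials `C_m`, `C_n` are ever coprime** (`C_k(0) ∈ {0, ±2}`, so `x ∣ C_k` in `𝔽₂[x]`); the engine is Mathlib's product formula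
# `C_m C_k = C_{m+k} + C_{m−k}` (no factor `2`), giving the Euclidean step `(C_{j+2m}, C_m) = (C_j, C_m)`, the reflection, and the descent of N458 verbatim

HONEST FRAMING. Part of the Lean index of the computation cell `pub-hsemireg` (seat p10 gen 48, Sunday typer «UNIFORM-IN-n»).  Polynomial ∕ ideal algebra and `ℕ`-parity bookkeeping only; no
variety, no cohomology theory, no sheaf, no Ext group and no semiregularity map is constructed here; nothing here says that HC / HC_CM / HC_AV holds; no Literature fact (unproved `Prop`) is
declared or used.  Custodian versions as in `WedgeHankelSiegelIdeal` (1/3).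
SOURCES (cited).  R. Lidl, G. L. Mullen, G. Turnwald, *Dickson Polynomials*, Pitman Monographs 65 (1993), Ch. 2 (`D_n(x, 1) = C_n`, functional equation, factorisation); M. Bhargava, M. E. Zieve,
*Factoring Dickson polynomials over finite fields*, Finite Fields Appl. 5 (1999) 103–111; M. O. Rayes, V. Trevisan, P. S. Wang, Comput. Math. Appl. 50 (2005) 1231–1240, Thm 4 (the `T`-form over
fields).  Typed here for IDEALS over arbitrary commutative rings; the `(2, C_g)` refinement is the content not visible over fields of characteristic `≠ 2`.
PROOF TYPED HERE.  Mathlib `Polynomial.Chebyshev.C_mul_C`, `C_neg`, `C_zero ∕ C_one`, `C_add_two ∕ C_sub_one`, `C_comp_two_mul_X`, `map_C`, `natDegree_T`, `Ideal.span_pair_add_mul_right`,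
`Ideal.span_insert_neg`, `Ideal.mem_span_pair`, `IsCoprime.map`, `Int.induction_on`; N458 `exists_fold_mod_two_mul`, `gcd_eq_and_odd_div_iff_of_eq_add ∕ _of_add_eq`; N459 `span_pair_eq_top_iff_isCoprime`.
DEDUP DISCLOSURE (`rg -n 'chebyshevC_' Summits Literature HarnessLib`, 2026-09-04): `Literature…ChebyshevChains.monic_chebyshevC_and_natDegree ∕ natDegree_chebyshevC ∕ isPermutableChain_chebyshevC` (degree,
monicity, permutability — different statements, not imported); 0 hits for the 11 names below.

WHAT IS IN THE TREE.  N457 (`U`), N458 (`T`), N465 (`S`); Literature `ChebyshevChains` (permutable chains).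
THIS FILE (namespace `Summit.Ventures.HSemireg.Wedge.HankelOuter` continued; CHAINED on N465; 0 definitions):
* §1231 `chebyshevC_span_pair_add_two_mul`, `chebyshevC_span_pair_add_mul_two_mul`, `chebyshevC_span_pair_two_mul_sub`, **`chebyshevC_span_pair_dichotomy`**, **`chebyshevC_span_pair_eq_span_gcd`**,
  **`chebyshevC_span_pair_eq_span_two_gcd`**, `chebyshevC_isCoprime_of_isUnit_two`, `chebyshevC_not_isCoprime_of_odd_odd`, `chebyshevC_eval_zero_zmod_two`, **`chebyshevC_not_isCoprime_int`**,
  `chebyshevC_int_span_pair_ne_top`.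
CAVEATS.  `ℕ`-division conventions as in N458.  Nothing Ext-side.  New names only.
-/

open Module Polynomial
open scoped Matrix Polynomial

namespace Summit.Ventures.HSemireg.Wedge.HankelOuter

/-! ## §1231. The ideal `(C_m, C_n)` (Vieta–Lucas ∕ Dickson polynomials) -/

/-- **Euclidean step `(C_{j+2m}, C_m) = (C_j, C_m)`** (all `j, m ∈ ℤ`, any commutative ring; from `C_m C_{j+m} = C_{j+2m} + C_j`). [Lidl–Mullen–Turnwald Ch. 2; this file, §1231] -/
theorem chebyshevC_span_pair_add_two_mul {R : Type*} [CommRing R] (j m : ℤ) :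
    Ideal.span {Polynomial.Chebyshev.C R (j + 2 * m), Polynomial.Chebyshev.C R m} =
      Ideal.span {Polynomial.Chebyshev.C R j, Polynomial.Chebyshev.C R m} := by
  have h := Polynomial.Chebyshev.C_mul_C R m (j + m)
  rw [show m + (j + m) = j + 2 * m by ring, show m - (j + m) = -j by ring, Polynomial.Chebyshev.C_neg] at h
  have hstep : Polynomial.Chebyshev.C R (j + 2 * m) = -Polynomial.Chebyshev.C R j + Polynomial.Chebyshev.C R (j + m) * Polynomial.Chebyshev.C R m := by
    linear_combination (-1 : R[X]) * h
  rw [hstep, Ideal.span_pair_add_mul_right, Ideal.span_insert_neg]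

/-- `(C_{j+k·2m}, C_m) = (C_j, C_m)` for every `k ∈ ℤ`. [this file, §1231] -/
theorem chebyshevC_span_pair_add_mul_two_mul {R : Type*} [CommRing R] (j m k : ℤ) :
    Ideal.span {Polynomial.Chebyshev.C R (j + k * (2 * m)), Polynomial.Chebyshev.C R m} =
      Ideal.span {Polynomial.Chebyshev.C R j, Polynomial.Chebyshev.C R m} := by
  induction k using Int.induction_on with
  | zero => rw [zero_mul, add_zero]
  | succ i ih => rw [add_mul, one_mul, ← add_assoc, chebyshevC_span_pair_add_two_mul, ih]
  | pred i ih =>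
    have h := chebyshevC_span_pair_add_two_mul (R := R) (j + (-(i : ℤ) - 1) * (2 * m)) m
    rw [show j + (-(i : ℤ) - 1) * (2 * m) + 2 * m = j + (-(i : ℤ)) * (2 * m) by ring, ih] at h
    exact h.symm

/-- Reflection `(C_{2m−j}, C_m) = (C_j, C_m)`. [this file, §1231] -/
theorem chebyshevC_span_pair_two_mul_sub {R : Type*} [CommRing R] (j m : ℤ) :
    Ideal.span {Polynomial.Chebyshev.C R (2 * m - j), Polynomial.Chebyshev.C R m} =
      Ideal.span {Polynomial.Chebyshev.C R j, Polynomial.Chebyshev.C R m} := by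
  rw [show 2 * m - j = -(j + (-1) * (2 * m)) by ring, Polynomial.Chebyshev.C_neg, chebyshevC_span_pair_add_mul_two_mul]

/-- **Dichotomy for the ideal `(C_m, C_n)` (any commutative ring): `= (C_{gcd(m,n)})` if `m ∕ gcd`, `n ∕ gcd` are both odd, `= (2, C_{gcd(m,n)})` otherwise** (`C_0 = 2`).
[Lidl–Mullen–Turnwald Ch. 2 ∕ Rayes–Trevisan–Wang Thm 4, ideal form with the `2`; this file, §1231] -/
theorem chebyshevC_span_pair_dichotomy {R : Type*} [CommRing R] (m n : ℕ) :
    (Odd (m / Nat.gcd m n) ∧ Odd (n / Nat.gcd m n) →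
        Ideal.span {Polynomial.Chebyshev.C R (m : ℤ), Polynomial.Chebyshev.C R (n : ℤ)} = Ideal.span {Polynomial.Chebyshev.C R (Nat.gcd m n : ℤ)}) ∧
      (¬ (Odd (m / Nat.gcd m n) ∧ Odd (n / Nat.gcd m n)) →
        Ideal.span {Polynomial.Chebyshev.C R (m : ℤ), Polynomial.Chebyshev.C R (n : ℤ)} = Ideal.span {2, Polynomial.Chebyshev.C R (Nat.gcd m n : ℤ)}) := by
  induction m using Nat.strong_induction_on generalizing n with
  | _ m ih =>
  rcases Nat.eq_zero_or_pos m with rfl | hm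
  · refine ⟨fun h => absurd h.1 (by rw [Nat.zero_div]; exact Nat.not_odd_zero), fun _ => ?_⟩
    rw [Nat.cast_zero, Polynomial.Chebyshev.C_zero, Nat.gcd_zero_left]
  · obtain ⟨j, hjm, q, hj⟩ := exists_fold_mod_two_mul hm n
    have hred : Ideal.span {Polynomial.Chebyshev.C R (m : ℤ), Polynomial.Chebyshev.C R (n : ℤ)} =
        Ideal.span {Polynomial.Chebyshev.C R (j : ℤ), Polynomial.Chebyshev.C R (m : ℤ)} ∧
        Nat.gcd m n = Nat.gcd m j ∧ (Odd (n / Nat.gcd m j) ↔ Odd (j / Nat.gcd m j)) := by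
      rcases hj with hj | hj
      · refine ⟨?_, gcd_eq_and_odd_div_iff_of_eq_add hj⟩
        rw [Ideal.span_pair_comm, hj, Nat.cast_add, Nat.cast_mul, Nat.cast_mul, Nat.cast_ofNat,
          show (j : ℤ) + 2 * (m : ℤ) * (q : ℤ) = j + (q : ℤ) * (2 * m) by ring, chebyshevC_span_pair_add_mul_two_mul]
      · refine ⟨?_, gcd_eq_and_odd_div_iff_of_add_eq hj⟩
        have hz : (n : ℤ) = -((j : ℤ) + (-(q : ℤ)) * (2 * m)) := by
          have e := congrArg (Nat.cast : ℕ → ℤ) hj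
          push_cast at e
          linarith
        rw [Ideal.span_pair_comm, hz, Polynomial.Chebyshev.C_neg, chebyshevC_span_pair_add_mul_two_mul]
    obtain ⟨hideal, hg1, hg2⟩ := hred
    rw [hideal, hg1, hg2]
    rcases Nat.lt_or_ge j m with hjlt | hjge
    · rcases Nat.eq_zero_or_pos j with rfl | hjpos
      · refine ⟨fun h => absurd h.2 (by rw [Nat.zero_div]; exact Nat.not_odd_zero), fun _ => ?_⟩
        rw [Nat.cast_zero, Polynomial.Chebyshev.C_zero, Nat.gcd_zero_right]
      · have h := ih j hjlt m
        rw [Nat.gcd_comm j m, show (Odd (j / Nat.gcd m j) ∧ Odd (m / Nat.gcd m j)) ↔ (Odd (m / Nat.gcd m j) ∧ Odd (j / Nat.gcd m j)) from And.comm] at h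
        exact h
    · obtain rfl : j = m := le_antisymm hjm hjge
      rw [Nat.gcd_self, Nat.div_self hm, Set.pair_eq_singleton]
      exact ⟨fun _ => rfl, fun h => absurd ⟨odd_one, odd_one⟩ h⟩

/-- **`(C_m, C_n) = (C_{gcd(m,n)})` when `m ∕ gcd`, `n ∕ gcd` are both odd** (any commutative ring). [this file, §1231] -/
theorem chebyshevC_span_pair_eq_span_gcd {R : Type*} [CommRing R] {m n : ℕ} (h : Odd (m / Nat.gcd m n) ∧ Odd (n / Nat.gcd m n)) :
    Ideal.span {Polynomial.Chebyshev.C R (m : ℤ), Polynomial.Chebyshev.C R (n : ℤ)} = Ideal.span {Polynomial.Chebyshev.C R (Nat.gcd m n : ℤ)} :=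
  (chebyshevC_span_pair_dichotomy m n).1 h

/-- **`(C_m, C_n) = (2, C_{gcd(m,n)})` unless `m ∕ gcd`, `n ∕ gcd` are both odd** (any commutative ring). [this file, §1231] -/
theorem chebyshevC_span_pair_eq_span_two_gcd {R : Type*} [CommRing R] {m n : ℕ} (h : ¬ (Odd (m / Nat.gcd m n) ∧ Odd (n / Nat.gcd m n))) :
    Ideal.span {Polynomial.Chebyshev.C R (m : ℤ), Polynomial.Chebyshev.C R (n : ℤ)} = Ideal.span {2, Polynomial.Chebyshev.C R (Nat.gcd m n : ℤ)} :=
  (chebyshevC_span_pair_dichotomy m n).2 h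

/-- If `2` is a unit of `R`: `C_m`, `C_n` are coprime unless `m ∕ gcd`, `n ∕ gcd` are both odd. [this file, §1231] -/
theorem chebyshevC_isCoprime_of_isUnit_two {R : Type*} [CommRing R] (h2 : IsUnit (2 : R)) {m n : ℕ} (h : ¬ (Odd (m / Nat.gcd m n) ∧ Odd (n / Nat.gcd m n))) :
    IsCoprime (Polynomial.Chebyshev.C R (m : ℤ)) (Polynomial.Chebyshev.C R (n : ℤ)) := by
  rw [← span_pair_eq_top_iff_isCoprime, chebyshevC_span_pair_eq_span_two_gcd h]
  refine Ideal.eq_top_of_isUnit_mem _ (Ideal.subset_span (Set.mem_insert _ _)) ?_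
  rw [show (2 : R[X]) = Polynomial.C 2 from (Polynomial.C_ofNat 2).symm]
  exact Polynomial.isUnit_C.2 h2

/-- Over a domain with `2 ≠ 0`: `m ∕ gcd`, `n ∕ gcd` both odd ⇒ `C_m`, `C_n` NOT coprime (`C_g(2X) = 2 T_g` has degree `g ≥ 1`). [this file, §1231] -/
theorem chebyshevC_not_isCoprime_of_odd_odd {R : Type*} [CommRing R] [IsDomain R] [NeZero (2 : R)] {m n : ℕ} (h : Odd (m / Nat.gcd m n) ∧ Odd (n / Nat.gcd m n)) :
    ¬ IsCoprime (Polynomial.Chebyshev.C R (m : ℤ)) (Polynomial.Chebyshev.C R (n : ℤ)) := by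
  intro hc
  have hg : Nat.gcd m n ≠ 0 := by
    intro h0
    rw [h0, Nat.div_zero] at h
    exact Nat.not_odd_zero h.1
  have htop := (span_pair_eq_top_iff_isCoprime _ _).2 hc
  rw [chebyshevC_span_pair_eq_span_gcd h, Ideal.span_singleton_eq_top] at htop
  obtain ⟨u, hu⟩ := htop
  -- compose with `2X`: `C_g(2X) = 2 T_g` would be a unit
  have hunit : IsUnit (2 * Polynomial.Chebyshev.T R (Nat.gcd m n : ℤ)) := by
    rw [← Polynomial.Chebyshev.C_comp_two_mul_X, ← hu]
    refine ⟨⟨(u : R[X]).comp (2 * Polynomial.X), (↑u⁻¹ : R[X]).comp (2 * Polynomial.X), ?_, ?_⟩, rfl⟩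
    · rw [← Polynomial.mul_comp, Units.mul_inv, Polynomial.one_comp]
    · rw [← Polynomial.mul_comp, Units.inv_mul, Polynomial.one_comp]
  have hdeg := Polynomial.natDegree_eq_zero_of_isUnit hunit
  rw [show (2 : R[X]) = Polynomial.C 2 from (Polynomial.C_ofNat 2).symm, Polynomial.natDegree_C_mul (NeZero.ne 2), Polynomial.Chebyshev.natDegree_T, Int.natAbs_natCast] at hdeg
  exact hg hdeg

/-- `C_n(0) = 0` in `𝔽₂` for every `n ∈ ℤ` (`C_n(0) ∈ {0, ±2}` over `ℤ`). [this file, §1231] -/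
theorem chebyshevC_eval_zero_zmod_two (n : ℤ) : (Polynomial.Chebyshev.C (ZMod 2) n).eval 0 = 0 := by
  induction n using Polynomial.Chebyshev.induct with
  | zero => rw [Polynomial.Chebyshev.C_zero, show (2 : (ZMod 2)[X]) = Polynomial.C 2 from (Polynomial.C_ofNat 2).symm, eval_C]; rfl
  | one => rw [Polynomial.Chebyshev.C_one, eval_X]
  | add_two n ih1 ih2 => rw [Polynomial.Chebyshev.C_add_two, eval_sub, eval_mul, eval_X, zero_mul, ih2, sub_zero]
  | neg_add_one n ih1 ih2 =>
    rw [Polynomial.Chebyshev.C_sub_one, eval_sub, eval_mul, eval_X, zero_mul, zero_sub, neg_eq_zero, show -(n : ℤ) + 1 = -(n : ℤ) + 1 from rfl]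
    exact ih2

/-- **No two Vieta–Lucas ∕ Dickson polynomials `C_m`, `C_n` (`m, n ∈ ℤ`) are coprime in `ℤ[X]`** (reduce modulo `2` and evaluate at `0`). [this file, §1231] -/
theorem chebyshevC_not_isCoprime_int (m n : ℤ) : ¬ IsCoprime (Polynomial.Chebyshev.C ℤ m) (Polynomial.Chebyshev.C ℤ n) := by
  intro h
  have h2 := h.map (Polynomial.mapRingHom (Int.castRingHom (ZMod 2)))
  rw [Polynomial.coe_mapRingHom, Polynomial.Chebyshev.map_C, Polynomial.Chebyshev.map_C] at h2
  obtain ⟨a, b, hab⟩ := h2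
  have e := congrArg (Polynomial.eval 0) hab
  rw [eval_add, eval_mul, eval_mul, chebyshevC_eval_zero_zmod_two, chebyshevC_eval_zero_zmod_two, mul_zero, mul_zero, add_zero, eval_one] at e
  exact zero_ne_one e

/-- Hence `(C_m, C_n) ≠ ℤ[X]` for all `m, n ∈ ℕ`: the ideal is `(C_{gcd})` or `(2, C_{gcd})`, both proper. [this file, §1231] -/
theorem chebyshevC_int_span_pair_ne_top (m n : ℕ) :
    Ideal.span {Polynomial.Chebyshev.C ℤ (m : ℤ), Polynomial.Chebyshev.C ℤ (n : ℤ)} ≠ ⊤ := fun h =>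
  chebyshevC_not_isCoprime_int (m : ℤ) (n : ℤ) ((span_pair_eq_top_iff_isCoprime _ _).1 h)

end Summit.Ventures.HSemireg.Wedge.HankelOuter
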